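import Literature.NumberTheory.EllipticCurves.HasseWeilAbelianConductor
import Literature.NumberTheory.EllipticCurves.GoodReductionUnramifiedProofs
import Literature.NumberTheory.GaloisRepresentations.ArtinConductorProofs
import Literature.NumberTheory.DiophantineGeometry.ConductorExponentZeroProofs
import Literature.NumberTheory.DiophantineGeometry.ConductorMultiplicativeProofs
import Literature.NumberTheory.DiophantineGeometry.ConductorTameProofs
import Literature.NumberTheory.DiophantineGeometry.TateAlgorithmAdditiveProofs
import Literature.RingTheory.DiscreteValuationRing.AdicCompletionResidueField
import HarnessLib

/-!
# The conductor exponent of `V_ℓ E`: the places of good reduction, and the C15 fact from its bad-place cases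

Sibling proof file (theorems only) of `HasseWeilAbelian` (trunk EllArithM, item C15) and of
the decomposition file `HasseWeilAbelianConductor` (tame and wild parts of `a_v(V_ℓ E)`,
Silverman *ATAEC* Thm. IV.10.2 / Ogg's formula IV.11.1), settling the **places of good
reduction** of the named fact
`WeierstrassCurve.artinConductorExponent_tate_eq_conductorExponent_of_isElliptic` (Ogg–Saito in
Galois form, `a_v(V_ℓ E) = f_v(E)` for `v ∤ ℓ`, elliptic `W`).

The input is Silverman *AEC* Prop. VII.4.1(b) — `V_ℓ E` is unramified at the places `v ∤ ℓ` of
good reduction — which the tree proves in `GoodReductionUnramifiedProofs`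
(`WeierstrassCurve.isUnramifiedAt_rationalTateGaloisRepOf_geomPoints`, from the reduction step
`smul_localPoints_eq_of_mem_inertia_holds` of the Selmer files and the local–global compatibility
of inertia `exists_mem_inertia_apply_eq_holds`, Neukirch II (9.6)).  From it, at a place `v ∤ ℓ`
of good reduction of an elliptic curve `E/K` over a number field and every prime `𝔓 ∣ v` of
`\bar ℤ_K` (all **proved** here):

* `codimFixed_inertia_rationalTate_eq_zero_of_hasGoodReductionAt`: `codim (V_ℓ E)^{I_𝔓} = 0`
  (Silverman *ATAEC* Thm. IV.10.2(a), good case: `ε(E/K) = 0`);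
* `swanConductorAt_rationalTate_eq_zero_of_hasGoodReductionAt`: `Sw_𝔓(V_ℓ E) = 0` (10.2(b), good
  case, via `GaloisRep.IsUnramifiedAtPrime.isTameAt_holds`);
* `conductorExponentOf_eq_zero_of_hasGoodReductionAt`: `a_v(V_ℓ E) = 0` (via
  `GaloisRep.artinConductorExponent_eq_zero_of_isUnramifiedAt_holds`, Serre *Local Fields* VI §2
  Thm. 1'(2));
* on the curve side `tameConductorExponent_kodairaSymbolAt_eq_zero_of_hasGoodReductionAt`
  (`ε_v = 0`: Tate's algorithm returns `I₀`, `isGood_kodairaSymbolAt_iff_holds`) and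
  `wildConductorExponent_eq_zero_of_hasGoodReductionAt` (`δ_v = f_v - ε_v = 0`, with `f_v = 0`
  from the discharged G22 fact `conductorExponent_eq_zero_iff_holds`; the residue field of `O_v`
  is finite, hence perfect: `Literature/RingTheory/DiscreteValuationRing/AdicCompletionResidueField`
  with Mathlib's `PerfectField.ofFinite`);
* whence **the C15 fact at the places of good reduction**,
  `artinConductorExponent_tate_eq_conductorExponent_of_hasGoodReductionAt`
  (`a_v(V_ℓ E) = 0 = f_v`; Ogg's formula IV.11.1, good case, PDF p. 366: "`v_K(𝒟_{E/K}) = 0`,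
  `f(E/K) = 0`, and `m(E/K) = 1`"), and `eventually_artinConductorExponent_tate_eq_conductorExponent`
  (it holds at all but finitely many `v ∤ ℓ`, `finite_badPlaces_holds`).

Then:

* Assemblies by the local trichotomy good/multiplicative/additive
  (`hasGoodReductionAt_or_hasMultiplicativeReductionAt_or_hasAdditiveReductionAt`):
  `codimFixed_inertia_rationalTate_eq_tameConductorExponent_of_mult_of_add` (Silverman *ATAEC*
  10.2(a) from its multiplicative and additive cases),
  `swanConductorAt_rationalTate_eq_wildConductorExponent_of_mult_of_add` (11.1, wild form, from its
  two bad cases), and `artinConductorExponent_tate_eq_conductorExponent_of_isElliptic_of_facts`: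
  **the C15 fact `artinConductorExponent_tate_eq_conductorExponent_of_isElliptic W ℓ` (hence bsd.S15
  `Literature.NumberTheory.EllipticCurves.conductorNorm_eq_artinConductorNat_of_isElliptic`) follows from the four bad-place facts
  of `HasseWeilAbelianConductor`** — tame and wild parts at the multiplicative places (Tate curve)
  and at the additive places (Serre–Tate `(V_ℓ E)^I = 0`; Ogg–Saito).  For a semistable curve only
  the two multiplicative facts are needed
  (`artinConductorExponent_tate_eq_conductorExponent_of_isSemistable_of_facts`); ideal form over
  `K`: `conductorOf_geomPoints_eq_conductor_of_isElliptic_of_tate` / `_of_facts`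
  (`𝔣^{(ℓ)}(V_ℓ E) = 𝔣(E/K)` when `f_v = 0` above `ℓ`); refinement by residue characteristic:
  `swanConductorAt_rationalTate_eq_wildConductorExponent_of_hasAdditiveReductionAt_of_ringChar`
  (Ogg's formula at the additive places from Thm. IV.10.2(b), clause `p ≥ 5`, and its `p = 2, 3`
  part) and `artinConductorExponent_tate_eq_conductorExponent_of_isElliptic_of_facts'`.

## References

* J. H. Silverman, *Advanced Topics in the Arithmetic of Elliptic Curves*, GTM 151 (1994), §IV.10
  Thm. 10.2 (PDF pp. 358–361), §IV.11 Ogg's formula 11.1 (PDF pp. 365–366). [SilvermanATAEC1994]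
* J. H. Silverman, *The Arithmetic of Elliptic Curves*, 2nd ed., GTM 106 (2009), Prop. VII.4.1,
  VII.5.1. [SilvermanAEC2009]
* J.-P. Serre, J. Tate, *Good reduction of abelian varieties*, Ann. of Math. 88 (1968), §1, §2.1,
  §3. [SerreTate1968]
-/

noncomputable section

open scoped Classical NumberField
open Field IsDedekindDomain

universe u

namespace WeierstrassCurve

open Literature.NumberTheory.EllipticCurves Literature.NumberTheory.GaloisRepresentations Literature.NumberTheory.DiophantineGeometry

variable {K : Type u} [Field K] [NumberField K] (W : WeierstrassCurve K) (ℓ : ℕ) [Fact ℓ.Prime]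

/-! ### Consequences of AEC VII.4.1(b) at the places of good reduction -/

/-- At a place `v ∤ ℓ` of good reduction the inertia invariants are everything:
`codim (V_ℓ E)^{I_𝔓} = 0` for every `𝔓 ∣ v` (Silverman *ATAEC* Thm. IV.10.2(a), good case:
`ε(E/K) = 0`; from `isUnramifiedAt_rationalTateGaloisRepOf_geomPoints`, *AEC* VII.4.1(b)).
[cite: SilvermanATAEC1994, Thm. IV.10.2(a), good reduction (PDF p. 358)] -/
theorem codimFixed_inertia_rationalTate_eq_zero_of_hasGoodReductionAt [W.IsElliptic]
    (h : Continuous fun x : absoluteGaloisGroup K × RationalTateModule (geomPoints W) ℓ ↦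
      rationalTateRepresentation (absoluteGaloisGroup K) (geomPoints W) ℓ x.1 x.2)
    {v : HeightOneSpectrum (𝓞 K)} (hv : W.HasGoodReductionAt v) (hℓ : (ℓ : 𝓞 K) ∉ v.asIdeal)
    {𝔓 : Ideal (absIntegers (𝓞 K) K)} (h𝔓 : 𝔓 ∈ v.primesAbove) :
    (rationalTateGaloisRepOf (geomPoints W) ℓ h).codimFixed (𝔓.inertia (absoluteGaloisGroup K)) =
      0 :=
  ContinuousRep.codimFixed_eq_zero_of_forall_eq_one _
    (W.isUnramifiedAt_rationalTateGaloisRepOf_geomPoints ℓ h hv hℓ 𝔓 h𝔓)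

/-- At a place `v ∤ ℓ` of good reduction the Swan conductor of `V_ℓ E` vanishes at every `𝔓 ∣ v`
(unramified implies tame, `GaloisRep.IsUnramifiedAtPrime.isTameAt_holds`; Silverman *ATAEC*
Thm. IV.10.2(b), good case: `δ(E/K) = 0`, "`L/K` is unramified from [AEC, VII.4.1], so the inertia
group `G₀(L/K)` is trivial", PDF p. 359).
[cite: SilvermanATAEC1994, Thm. IV.10.2(b), good reduction (PDF p. 359)] -/
theorem swanConductorAt_rationalTate_eq_zero_of_hasGoodReductionAt [W.IsElliptic]
    (h : Continuous fun x : absoluteGaloisGroup K × RationalTateModule (geomPoints W) ℓ ↦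
      rationalTateRepresentation (absoluteGaloisGroup K) (geomPoints W) ℓ x.1 x.2)
    {v : HeightOneSpectrum (𝓞 K)} (hv : W.HasGoodReductionAt v) (hℓ : (ℓ : 𝓞 K) ∉ v.asIdeal)
    {𝔓 : Ideal (absIntegers (𝓞 K) K)} (h𝔓 : 𝔓 ∈ v.primesAbove) :
    (rationalTateGaloisRepOf (geomPoints W) ℓ h).swanConductorAt (𝓞 K) 𝔓 = 0 :=
  (GaloisRep.IsUnramifiedAtPrime.isTameAt_holds
    (W.isUnramifiedAt_rationalTateGaloisRepOf_geomPoints ℓ h hv hℓ 𝔓 h𝔓)).swanConductorAt_eq_zero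

/-- At a place `v ∤ ℓ` of good reduction the Artin conductor exponent of `V_ℓ E` vanishes:
`a_v(V_ℓ E) = 0` (`Literature.NumberTheory.EllipticCurves.conductorExponentOf`; Serre, *Local Fields*, VI §2 Thm. 1'(2) in the form
`GaloisRep.artinConductorExponent_eq_zero_of_isUnramifiedAt_holds`, fed with *AEC* VII.4.1(b)).
[cite: SerreTate1968, §2.1] [cite: SilvermanATAEC1994, Thm. IV.10.2(b), good reduction] -/
theorem conductorExponentOf_eq_zero_of_hasGoodReductionAt [W.IsElliptic]
    (h : Continuous fun x : absoluteGaloisGroup K × RationalTateModule (geomPoints W) ℓ ↦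
      rationalTateRepresentation (absoluteGaloisGroup K) (geomPoints W) ℓ x.1 x.2)
    {v : HeightOneSpectrum (𝓞 K)} (hv : W.HasGoodReductionAt v) (hℓ : (ℓ : 𝓞 K) ∉ v.asIdeal) :
    conductorExponentOf (geomPoints W) ℓ h v = 0 :=
  GaloisRep.artinConductorExponent_eq_zero_of_isUnramifiedAt_holds
    (W.isUnramifiedAt_rationalTateGaloisRepOf_geomPoints ℓ h hv hℓ)

omit [Fact ℓ.Prime] in
/-- `ε_v = 0` at a place of good reduction of an elliptic curve over a number field: Tate's
algorithm returns `I₀` (`isGood_kodairaSymbolAt_iff_holds`; the residue field of `O_v` is finite,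
hence perfect). Silverman *ATAEC* IV.9.4 Step 1, Thm. IV.10.2(a).
[cite: SilvermanATAEC1994, Thm. IV.10.2(a), good reduction] -/
theorem tameConductorExponent_kodairaSymbolAt_eq_zero_of_hasGoodReductionAt [W.IsElliptic]
    {v : HeightOneSpectrum (𝓞 K)} (hv : W.HasGoodReductionAt v) :
    (W.kodairaSymbolAt v).tameConductorExponent = 0 :=
  (KodairaSymbol.tameConductorExponent_eq_zero_iff _).mpr ((isGood_kodairaSymbolAt_iff_holds v W).mpr hv)

omit [Fact ℓ.Prime] in
/-- `δ_v = f_v - ε_v = 0` at a place of good reduction, `f_v = 0` being the discharged G22 fact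
`conductorExponent_eq_zero_iff_holds` (cf. `conductorExponent_eq_zero_of_hasGoodReductionAt` in
`PAdicLFunctionNeZeroProofs`). Silverman *ATAEC* Thm. IV.10.2(b).
[cite: SilvermanATAEC1994, Thm. IV.10.2(b), good reduction] -/
theorem wildConductorExponent_eq_zero_of_hasGoodReductionAt [W.IsElliptic]
    {v : HeightOneSpectrum (𝓞 K)} (hv : W.HasGoodReductionAt v) : W.wildConductorExponent v = 0 := by
  rw [wildConductorExponent, (conductorExponent_eq_zero_iff_holds v W).mpr hv, Nat.zero_sub]

/-- **The C15 fact at the places of good reduction** (Ogg–Saito / Silverman *ATAEC* IV.11.1,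
good case: "`v_K(𝒟_{E/K}) = 0`, `f(E/K) = 0`, and `m(E/K) = 1`", PDF p. 366; here
`a_v(V_ℓ E) = 0 = f_v`).  For an elliptic curve `E/K` over a number field, a prime `ℓ` and a place
`v ∤ ℓ` of good reduction, `conductorExponentOf (geomPoints W) ℓ h v = W.conductorExponent v`.
[cite: SilvermanATAEC1994, IV.11.1, good reduction case (PDF p. 366)] [cite: SerreTate1968, §2.1] -/
theorem artinConductorExponent_tate_eq_conductorExponent_of_hasGoodReductionAt [W.IsElliptic]
    (h : Continuous fun x : absoluteGaloisGroup K × RationalTateModule (geomPoints W) ℓ ↦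
      rationalTateRepresentation (absoluteGaloisGroup K) (geomPoints W) ℓ x.1 x.2)
    {v : HeightOneSpectrum (𝓞 K)} (hv : W.HasGoodReductionAt v) (hℓ : (ℓ : 𝓞 K) ∉ v.asIdeal) :
    conductorExponentOf (geomPoints W) ℓ h v = W.conductorExponent v := by
  rw [W.conductorExponentOf_eq_zero_of_hasGoodReductionAt ℓ h hv hℓ,
    (conductorExponent_eq_zero_iff_holds v W).mpr hv]

/-- The C15 fact holds at all but finitely many places: for every `v ∤ ℓ` outside the finite set
of bad places (`eventually_hasGoodReductionAt` / `finite_badPlaces_holds`, Silverman *AEC*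
Rem. VIII.1.3). [cite: SilvermanATAEC1994, IV.11.1, good reduction case] -/
theorem eventually_artinConductorExponent_tate_eq_conductorExponent [W.IsElliptic]
    (h : Continuous fun x : absoluteGaloisGroup K × RationalTateModule (geomPoints W) ℓ ↦
      rationalTateRepresentation (absoluteGaloisGroup K) (geomPoints W) ℓ x.1 x.2) :
    ∀ᶠ v : HeightOneSpectrum (𝓞 K) in Filter.cofinite, (ℓ : 𝓞 K) ∉ v.asIdeal →
      conductorExponentOf (geomPoints W) ℓ h v = W.conductorExponent v := by
  have hfin : (W.badPlaces (𝓞 K)).Finite := finite_badPlaces_holds (𝓞 K) W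
  refine Filter.Eventually.mono hfin.compl_mem_cofinite fun v hv hℓ ↦ ?_
  exact W.artinConductorExponent_tate_eq_conductorExponent_of_hasGoodReductionAt ℓ h
    (not_not.mp ((W.mem_badPlaces_iff v).not.mp hv)) hℓ

/-- The same with the tree's continuity theorem supplied
(`continuous_rationalGaloisRepTate_holds`): the C15 fact at a good place `v ∤ ℓ` for the
canonical continuity witness. [cite: SilvermanATAEC1994, IV.11.1, good reduction case] -/
theorem artinConductorExponent_tate_eq_conductorExponent_of_hasGoodReductionAt' [W.IsElliptic]
    {v : HeightOneSpectrum (𝓞 K)} (hv : W.HasGoodReductionAt v) (hℓ : (ℓ : 𝓞 K) ∉ v.asIdeal) :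
    conductorExponentOf (geomPoints W) ℓ (W.continuous_rationalGaloisRepTate_holds ℓ) v =
      W.conductorExponent v :=
  W.artinConductorExponent_tate_eq_conductorExponent_of_hasGoodReductionAt ℓ _ hv hℓ

/-! ### Assemblies: the C15 fact from its cases at the bad places -/

/-- **Silverman *ATAEC* Thm. IV.10.2(a) from its multiplicative and additive cases** (the good
case being the theorem `codimFixed_inertia_rationalTate_eq_zero_of_hasGoodReductionAt`), by the
local trichotomy and the correctness of Tate's algorithm's reduction type
(`isGood_kodairaSymbolAt_iff_holds`, `isAdditive_kodairaSymbolAt_iff_holds`).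
[cite: SilvermanATAEC1994, Thm. IV.10.2(a) (PDF pp. 358–360)] -/
theorem codimFixed_inertia_rationalTate_eq_tameConductorExponent_of_mult_of_add
    (hm : W.codimFixed_inertia_rationalTate_eq_one_of_hasMultiplicativeReductionAt ℓ)
    (ha : W.codimFixed_inertia_rationalTate_eq_two_of_hasAdditiveReductionAt ℓ) :
    W.codimFixed_inertia_rationalTate_eq_tameConductorExponent ℓ := by
  intro _ h v hℓ 𝔓 h𝔓
  rcases W.hasGoodReductionAt_or_hasMultiplicativeReductionAt_or_hasAdditiveReductionAt v with
    hv | hv | hv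
  · rw [W.codimFixed_inertia_rationalTate_eq_zero_of_hasGoodReductionAt ℓ h hv hℓ h𝔓,
      W.tameConductorExponent_kodairaSymbolAt_eq_zero_of_hasGoodReductionAt hv]
  · have hng : ¬ (W.kodairaSymbolAt v).IsGood := fun hg ↦
      hv.not_hasGoodReductionAt ((isGood_kodairaSymbolAt_iff_holds v W).mp hg)
    have hna : ¬ (W.kodairaSymbolAt v).IsAdditive := fun ha' ↦
      hv.not_hasAdditiveReductionAt ((isAdditive_kodairaSymbolAt_iff_holds v W).mp ha')
    have hmul : (W.kodairaSymbolAt v).IsMultiplicative := by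
      by_contra hc
      exact hna ⟨hng, hc⟩
    rw [hm h v hℓ hv h𝔓, eq_comm, KodairaSymbol.tameConductorExponent_eq_one_iff]
    exact hmul
  · rw [ha h v hℓ hv h𝔓, eq_comm, KodairaSymbol.tameConductorExponent_eq_two_iff]
    exact (isAdditive_kodairaSymbolAt_iff_holds v W).mpr hv

/-- **Ogg's formula for the wild part from its multiplicative and additive cases** (the good case
being the theorems `swanConductorAt_rationalTate_eq_zero_of_hasGoodReductionAt` and
`wildConductorExponent_eq_zero_of_hasGoodReductionAt`); at a multiplicative place the curve side
is `δ_v = f_v - ε_v = 1 - 1 = 0` (`conductorExponent_eq_tameConductorExponent_add_wildConductorExponent_holds`,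
`conductorExponent_eq_one_iff_holds`). Silverman *ATAEC* IV.11.1, proof, PDF p. 366.
[cite: SilvermanATAEC1994, IV.11.1 Ogg's formula (PDF pp. 365–366)] -/
theorem swanConductorAt_rationalTate_eq_wildConductorExponent_of_mult_of_add
    (hm : W.swanConductorAt_rationalTate_eq_zero_of_hasMultiplicativeReductionAt ℓ)
    (ha : W.swanConductorAt_rationalTate_eq_wildConductorExponent_of_hasAdditiveReductionAt ℓ) :
    W.swanConductorAt_rationalTate_eq_wildConductorExponent ℓ := by
  intro _ h v hℓ 𝔓 h𝔓
  rcases W.hasGoodReductionAt_or_hasMultiplicativeReductionAt_or_hasAdditiveReductionAt v with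
    hv | hv | hv
  · rw [W.swanConductorAt_rationalTate_eq_zero_of_hasGoodReductionAt ℓ h hv hℓ h𝔓,
      W.wildConductorExponent_eq_zero_of_hasGoodReductionAt hv, Nat.cast_zero]
  · have hf : W.conductorExponent v = 1 := (conductorExponent_eq_one_iff_holds v W).mpr hv
    have hng : ¬ (W.kodairaSymbolAt v).IsGood := fun hg ↦
      hv.not_hasGoodReductionAt ((isGood_kodairaSymbolAt_iff_holds v W).mp hg)
    have hna : ¬ (W.kodairaSymbolAt v).IsAdditive := fun ha' ↦
      hv.not_hasAdditiveReductionAt ((isAdditive_kodairaSymbolAt_iff_holds v W).mp ha')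
    have hmul : (W.kodairaSymbolAt v).IsMultiplicative := by
      by_contra hc
      exact hna ⟨hng, hc⟩
    have hε : (W.kodairaSymbolAt v).tameConductorExponent = 1 :=
      (KodairaSymbol.tameConductorExponent_eq_one_iff _).mpr hmul
    have hδ : W.wildConductorExponent v = 0 := by
      rw [wildConductorExponent, hf, hε]
    rw [hm h v hℓ hv h𝔓, hδ, Nat.cast_zero]
  · exact ha h v hℓ hv h𝔓

/-- **The C15 fact from the four bad-place facts.**  Ogg–Saito in Galois form,
`artinConductorExponent_tate_eq_conductorExponent_of_isElliptic W ℓ` (`a_v(V_ℓ E) = f_v(E)` for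
`v ∤ ℓ`, elliptic `W`; the input of bsd.S15 `Literature.NumberTheory.EllipticCurves.conductorNorm_eq_artinConductorNat_of_isElliptic`
through `BSDConductorProofs`), follows from Silverman *ATAEC* Thm. IV.10.2(a) at the multiplicative
and additive places (`codimFixed_inertia_rationalTate_eq_one_of_hasMultiplicativeReductionAt`,
`…_eq_two_of_hasAdditiveReductionAt`), Thm. IV.10.2(b) at the multiplicative places
(`swanConductorAt_rationalTate_eq_zero_of_hasMultiplicativeReductionAt`) and Ogg's formula
IV.11.1 at the additive places
(`swanConductorAt_rationalTate_eq_wildConductorExponent_of_hasAdditiveReductionAt`); the places of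
good reduction are handled by the theorems of this file, and `a_v = ⌊ε_v + δ_v⌋₊ = f_v` is
`artinConductorExponent_tate_eq_conductorExponent_of_isElliptic_of_tame_of_wild`.
[cite: SilvermanATAEC1994, Thm. IV.10.2 and IV.11.1 (PDF pp. 358–366)] [cite: SerreTate1968, §2.1, §3] -/
theorem artinConductorExponent_tate_eq_conductorExponent_of_isElliptic_of_facts
    (hTm : W.codimFixed_inertia_rationalTate_eq_one_of_hasMultiplicativeReductionAt ℓ)
    (hTa : W.codimFixed_inertia_rationalTate_eq_two_of_hasAdditiveReductionAt ℓ)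
    (hWm : W.swanConductorAt_rationalTate_eq_zero_of_hasMultiplicativeReductionAt ℓ)
    (hWa : W.swanConductorAt_rationalTate_eq_wildConductorExponent_of_hasAdditiveReductionAt ℓ) :
    W.artinConductorExponent_tate_eq_conductorExponent_of_isElliptic ℓ :=
  W.artinConductorExponent_tate_eq_conductorExponent_of_isElliptic_of_tame_of_wild ℓ
    (W.codimFixed_inertia_rationalTate_eq_tameConductorExponent_of_mult_of_add ℓ hTm hTa)
    (W.swanConductorAt_rationalTate_eq_wildConductorExponent_of_mult_of_add ℓ hWm hWa)

/-- **Semistable curves.**  If `E` is semistable (good or multiplicative reduction everywhere,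
`W.IsSemistable (𝓞 K)`), the C15 fact at every `v ∤ ℓ` follows from the two multiplicative-place
facts alone (Silverman *ATAEC* Thm. IV.10.2(a),(b) via the Tate curve; Example 10.5:
`𝔣(E/K) = ∏_{𝔭 ∣ 𝒟} 𝔭`). [cite: SilvermanATAEC1994, Thm. IV.10.2 and Example 10.5 (PDF pp. 358–364)] -/
theorem artinConductorExponent_tate_eq_conductorExponent_of_isSemistable_of_facts [W.IsElliptic]
    (hs : W.IsSemistable (𝓞 K))
    (hTm : W.codimFixed_inertia_rationalTate_eq_one_of_hasMultiplicativeReductionAt ℓ)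
    (hWm : W.swanConductorAt_rationalTate_eq_zero_of_hasMultiplicativeReductionAt ℓ)
    (h : Continuous fun x : absoluteGaloisGroup K × RationalTateModule (geomPoints W) ℓ ↦
      rationalTateRepresentation (absoluteGaloisGroup K) (geomPoints W) ℓ x.1 x.2)
    (v : HeightOneSpectrum (𝓞 K)) (hℓ : (ℓ : 𝓞 K) ∉ v.asIdeal) :
    conductorExponentOf (geomPoints W) ℓ h v = W.conductorExponent v := by
  have hTa : W.codimFixed_inertia_rationalTate_eq_two_of_hasAdditiveReductionAt ℓ := by
    intro _ h' w _ hw 𝔓 _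
    exact absurd hw ((hs w).elim (fun hg ↦ hg.not_hasAdditiveReductionAt)
      fun hm' ↦ hm'.not_hasAdditiveReductionAt)
  have hWa : W.swanConductorAt_rationalTate_eq_wildConductorExponent_of_hasAdditiveReductionAt ℓ := by
    intro _ h' w _ hw 𝔓 _
    exact absurd hw ((hs w).elim (fun hg ↦ hg.not_hasAdditiveReductionAt)
      fun hm' ↦ hm'.not_hasAdditiveReductionAt)
  exact W.artinConductorExponent_tate_eq_conductorExponent_of_isElliptic_of_facts ℓ hTm hTa hWm hWa
    h v hℓ


/-- **Semistable curves, packaged.**  For a semistable `W` the corrected C15 fact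
`artinConductorExponent_tate_eq_conductorExponent_of_isElliptic W ℓ` itself follows from the two
multiplicative-place facts (so that, over `ℚ`, bsd.S15 `Literature.BSD.conductorNorm_eq_artinConductorNat_of_isElliptic W ℓ`
for semistable `W` needs only the Tate-curve inputs, via `BSDConductorProofs`).
[cite: SilvermanATAEC1994, Thm. IV.10.2 and Example 10.5 (PDF pp. 358–364)] -/
theorem artinConductorExponent_tate_eq_conductorExponent_of_isElliptic_of_isSemistable
    (hs : W.IsSemistable (𝓞 K))
    (hTm : W.codimFixed_inertia_rationalTate_eq_one_of_hasMultiplicativeReductionAt ℓ)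
    (hWm : W.swanConductorAt_rationalTate_eq_zero_of_hasMultiplicativeReductionAt ℓ) :
    W.artinConductorExponent_tate_eq_conductorExponent_of_isElliptic ℓ :=
  fun h v hℓ ↦
    W.artinConductorExponent_tate_eq_conductorExponent_of_isSemistable_of_facts ℓ hs hTm hWm h v hℓ

/-! ### The ideal form over a number field -/

/-- **The conductor ideal from the Tate module, for elliptic `W`** (corrected, elliptic-only form of
the C15 schema `artinConductor_tate_eq_conductor`, derived from the exponentwise fact): for an
elliptic curve `E/K` over a number field and a prime `ℓ` with `f_v(E) = 0` at every `v ∣ ℓ`, the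
prime-to-`ℓ` Artin conductor ideal `𝔣^{(ℓ)}(V_ℓ E) = ∏_{v ∤ ℓ} v ^ {a_v(V_ℓ E)}` (`Literature.NumberTheory.EllipticCurves.conductorOf`)
is the conductor ideal `𝔣(E/K) = ∏_v v ^ {f_v}` (`WeierstrassCurve.conductor (𝓞 K)`; Silverman
*ATAEC* §IV.10, Definition of `𝔣(E/K)`, PDF p. 364), granted
`artinConductorExponent_tate_eq_conductorExponent_of_isElliptic W ℓ` (factorwise: `a_v = f_v` for
`v ∤ ℓ`, and both factors are `1` at `v ∣ ℓ`).
[cite: SilvermanATAEC1994, §IV.10 Definition of the conductor (PDF p. 364)] [cite: SerreTate1968, §2.1] -/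
theorem conductorOf_geomPoints_eq_conductor_of_isElliptic_of_tate [W.IsElliptic]
    (hA : W.artinConductorExponent_tate_eq_conductorExponent_of_isElliptic ℓ)
    (h : Continuous fun x : absoluteGaloisGroup K × RationalTateModule (geomPoints W) ℓ ↦
      rationalTateRepresentation (absoluteGaloisGroup K) (geomPoints W) ℓ x.1 x.2)
    (hℓ : ∀ v : HeightOneSpectrum (𝓞 K), (ℓ : 𝓞 K) ∈ v.asIdeal → W.conductorExponent v = 0) :
    conductorOf (geomPoints W) ℓ h = W.conductor (𝓞 K) := by
  unfold conductorOf WeierstrassCurve.conductor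
  refine finprod_congr fun v ↦ ?_
  by_cases hv : (ℓ : 𝓞 K) ∈ v.asIdeal
  · rw [if_pos hv, hℓ v hv, pow_zero]
  · rw [if_neg hv]
    exact congrArg (v.asIdeal ^ ·) (hA h v hv)

/-- The same from the four bad-place facts of `HasseWeilAbelianConductor`
(`artinConductorExponent_tate_eq_conductorExponent_of_isElliptic_of_facts`).
[cite: SilvermanATAEC1994, §IV.10 Definition of the conductor (PDF p. 364) with Thm. IV.10.2, IV.11.1] -/
theorem conductorOf_geomPoints_eq_conductor_of_isElliptic_of_facts [W.IsElliptic]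
    (hTm : W.codimFixed_inertia_rationalTate_eq_one_of_hasMultiplicativeReductionAt ℓ)
    (hTa : W.codimFixed_inertia_rationalTate_eq_two_of_hasAdditiveReductionAt ℓ)
    (hWm : W.swanConductorAt_rationalTate_eq_zero_of_hasMultiplicativeReductionAt ℓ)
    (hWa : W.swanConductorAt_rationalTate_eq_wildConductorExponent_of_hasAdditiveReductionAt ℓ)
    (h : Continuous fun x : absoluteGaloisGroup K × RationalTateModule (geomPoints W) ℓ ↦
      rationalTateRepresentation (absoluteGaloisGroup K) (geomPoints W) ℓ x.1 x.2)
    (hℓ : ∀ v : HeightOneSpectrum (𝓞 K), (ℓ : 𝓞 K) ∈ v.asIdeal → W.conductorExponent v = 0) :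
    conductorOf (geomPoints W) ℓ h = W.conductor (𝓞 K) :=
  W.conductorOf_geomPoints_eq_conductor_of_isElliptic_of_tate ℓ
    (W.artinConductorExponent_tate_eq_conductorExponent_of_isElliptic_of_facts ℓ hTm hTa hWm hWa) h hℓ

/-! ### Refinement by residue characteristic (Thm. IV.10.2(b), clause `p ≥ 5`) -/

/-- **Ogg's formula at the additive places from Thm. IV.10.2(b) and its `p = 2, 3` part.**  At an
additive place `v ∤ ℓ` whose residue characteristic is neither `2` nor `3`, both sides vanish:
`Sw_𝔓(V_ℓ E) = 0` is Silverman *ATAEC* Thm. IV.10.2(b), clause `p ≥ 5`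
(`swanConductorAt_rationalTate_eq_zero_of_ringChar_ne`), and `δ_v = 0` is the discharged G22 fact
`conductorExponent_eq_tameConductorExponent_holds` (`wildConductorExponent_eq_zero`); at residue
characteristic `2` or `3` it is the fact `swanConductorAt_rationalTate_eq_wildConductorExponent_of_ringChar_eq`
(Ogg `p = 3`, Saito `p = 2`).  This is the printed case split of the proof of 11.1 (PDF p. 366).
[cite: SilvermanATAEC1994, IV.11.1 proof (PDF p. 366) with Thm. IV.10.2(b)] -/
theorem swanConductorAt_rationalTate_eq_wildConductorExponent_of_hasAdditiveReductionAt_of_ringChar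
    (hW5 : W.swanConductorAt_rationalTate_eq_zero_of_ringChar_ne ℓ)
    (hW23 : W.swanConductorAt_rationalTate_eq_wildConductorExponent_of_ringChar_eq ℓ) :
    W.swanConductorAt_rationalTate_eq_wildConductorExponent_of_hasAdditiveReductionAt ℓ := by
  intro _ h v hℓ hv 𝔓 h𝔓
  by_cases h23 : ringChar (𝓞 K ⧸ v.asIdeal) = 2 ∨ ringChar (𝓞 K ⧸ v.asIdeal) = 3
  · exact hW23 h v hℓ hv h23 h𝔓
  · rw [not_or] at h23
    rw [hW5 h v hℓ h23.1 h23.2 h𝔓,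
      wildConductorExponent_eq_zero v W (conductorExponent_eq_tameConductorExponent_holds v W)
        h23.1 h23.2, Nat.cast_zero]

/-- **The C15 fact from Thm. IV.10.2 and Ogg–Saito at `p = 2, 3`.**  Ogg–Saito in Galois form,
`artinConductorExponent_tate_eq_conductorExponent_of_isElliptic W ℓ`, follows from Silverman
*ATAEC* Thm. IV.10.2(a) at the bad places (`hTm`, `hTa`), Thm. IV.10.2(b) (multiplicative places
`hWm`, residue characteristic `≠ 2, 3` `hW5`) and Ogg's formula at the additive places of residue
characteristic `2, 3` (`hW23`) — the places of good reduction and the bookkeeping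
`a_v = ⌊ε_v + δ_v⌋₊ = f_v` being theorems.
[cite: SilvermanATAEC1994, Thm. IV.10.2 and IV.11.1 (PDF pp. 358–370)] [cite: SerreTate1968, §2.1, §3] -/
theorem artinConductorExponent_tate_eq_conductorExponent_of_isElliptic_of_facts'
    (hTm : W.codimFixed_inertia_rationalTate_eq_one_of_hasMultiplicativeReductionAt ℓ)
    (hTa : W.codimFixed_inertia_rationalTate_eq_two_of_hasAdditiveReductionAt ℓ)
    (hWm : W.swanConductorAt_rationalTate_eq_zero_of_hasMultiplicativeReductionAt ℓ)
    (hW5 : W.swanConductorAt_rationalTate_eq_zero_of_ringChar_ne ℓ)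
    (hW23 : W.swanConductorAt_rationalTate_eq_wildConductorExponent_of_ringChar_eq ℓ) :
    W.artinConductorExponent_tate_eq_conductorExponent_of_isElliptic ℓ :=
  W.artinConductorExponent_tate_eq_conductorExponent_of_isElliptic_of_facts ℓ hTm hTa hWm
    (W.swanConductorAt_rationalTate_eq_wildConductorExponent_of_hasAdditiveReductionAt_of_ringChar ℓ
      hW5 hW23)

end WeierstrassCurve

end
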